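import Summits.ABC.IUTFork.Conditional.Layer2OfSa
import Summits.ABC.IUTFork.Conditional.Layer2OfSb
import HarnessLib

/-!
# L2 LAYER CERTIFICATE (top) — the [EtTh] members of the [IUTchIII] Cor 3.12 cone modulo S, for the apex `Conditional/AbcOfS`

abc-iut cell, director-abc 2026-08-26T05:19:55Z (C2); C lead abc-iut-plan (plan/C/ABC-OF-S-SPEC.md §3); shape = plan/L6/CERT-L6.md §1
(= `Conditional/Layer6OfS.lean`). Seat abc-iut-w6-d071 (wave W6, block C), row CERT-L2. Parts: `Layer2OfSa.lean` ([EtTh] §1–§2, 53 nodes)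
and `Layer2OfSb.lean` ([EtTh] §3–§5, 52 nodes); MAP of record HOME/staging/w6/w6-d071/cert/CERT-L2-MAP-v0.tsv.

THIS FILE PROVES NOTHING NEW AND ASSERTS NOTHING. It conjoins the two part residuals into the ONE binder the apex takes for layer L2 and
derives the whole L2 cone slice from it BY NAME.

COUNT LINE (L2 cone, plan/CONE-BOARD.tsv @06:06:26Z ∩ L2 = 105 nodes; STATUS SOURCE plan/DAG.tsv @06:00:22Z):
**105 = d 19 (DAG-discharged claim nodes: A 11 + B 8; + 82 witnessed discharge sub-rows conjoined, A 10 + B 72) + r 63 (Residual = the L2 entries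
of the C scoreboard: A 28 + B 35; 21 of them carry an L2-lead CONE-L2-STATUS v2.3 verdict «DISCHARGED…/PROVED…» and move at v1 on the lead's
word; FACT-policy nodes tagged per line) + d_data 19 (K4 data aliases, name-checked: A 10 + B 9) + not-indexed 4 (K5: Cor2.8(ii),
Cor2.19(i)(ii)(iii)).  19 + 63 + 19 + 4 = 105.**  S consumed at L2: NO.  KERNEL NOTE: `Layer2Residual` is inhabited by the index's `_part`
witnesses (`layer2Residual_inhabited`) — «residual» is a STATUS label (DAG/NODES), not an open kernel obligation.
HONEST FRAMING: typed ≠ proved; indexed ≠ endorsed; witnessed ≠ lead-discharged; nothing here asserts that abc is proved or refuted or takes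
a side on [IUTchIII] Cor. 3.12. [claim: Mochizuki2012, status: disputed]
-/

namespace Summit.ABC.IUTFork.Conditional

universe u₁ u₂ u₃ u₄ u₅ u₆ u₇ u₈ u₉ u₁₀

/-- **The L2 binder of the apex**: the residual conjunctions of both parts. [claim: Mochizuki2012, status: disputed] -/
def Layer2Residual : Prop :=
  Layer2ResidualA.{u₁, u₂, u₃, u₄, u₅, u₆} ∧ Layer2ResidualB.{u₁, u₂, u₃, u₄, u₅, u₆, u₇}

/-- **The L2 slice of the cone**: both parts, discharged ∧ residual. [claim: Mochizuki2012, status: disputed] -/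
def Layer2Cone : Prop :=
  Layer2ConeA.{u₁, u₂, u₃, u₄, u₅, u₆} ∧ Layer2ConeB.{u₁, u₂, u₃, u₄, u₅, u₆, u₇, u₈, u₉, u₁₀}

/-- The L2 slice follows from its residual binder alone (discharged halves witnessed BY NAME in the parts).
[claim: Mochizuki2012, status: disputed] -/
theorem layer2Cone_of (h : Layer2Residual.{u₁, u₂, u₃, u₄, u₅, u₆, u₇}) :
    Layer2Cone.{u₁, u₂, u₃, u₄, u₅, u₆, u₇, u₈, u₉, u₁₀} :=
  ⟨layer2ConeA_of h.1, layer2ConeB_of h.2⟩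

/-- KERNEL NOTE made checkable: the L2 binder is inhabited by the index's partial witnesses BY NAME. [claim: Mochizuki2012, status: disputed] -/
theorem layer2Residual_inhabited : Layer2Residual.{u₁, u₂, u₃, u₄, u₅, u₆, u₇} :=
  ⟨layer2ResidualA_inhabited, layer2ResidualB_inhabited⟩

/-- Hence the whole L2 slice of the cone is inhabited (status labels aside). [claim: Mochizuki2012, status: disputed] -/
theorem layer2Cone_inhabited : Layer2Cone.{u₁, u₂, u₃, u₄, u₅, u₆, u₇, u₈, u₉, u₁₀} :=
  layer2Cone_of layer2Residual_inhabited

/-- LAYER CENSUS L2 (bookkeeping arithmetic over the MAP counts): parts A + B, classes d + r + d_data + not-indexed. [folklore] -/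
theorem layer2_census_v0 : (11 + 8 : ℕ) = 19 ∧ (28 + 35 : ℕ) = 63 ∧ (10 + 9 : ℕ) = 19 ∧ (19 + 63 + 19 + 4 : ℕ) = 105 ∧
    (53 + 52 : ℕ) = 105 := ⟨rfl, rfl, rfl, rfl, rfl⟩

end Summit.ABC.IUTFork.Conditional
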